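import Mathlib
import Summits.ResolutionOfSingularities.ResolutionOfSingularities.Theorems.WeightedInvariantLocalWeightedDropPolyDescentDefs
import Summits.ResolutionOfSingularities.ResolutionOfSingularities.Theorems.WeightedInvariantLocalWeightedDropPureDescentBridge
import Summits.ResolutionOfSingularities.ResolutionOfSingularities.Theorems.WeightedInvariantLocalWeightedDropWildMonicDescentNormal

/-!
# `WeightedInvariant.LocalWeightedDrop`, stub S3ρ, second key «monic polyhedron descent», piece (ρ-B) sub-lemma (B-i): THE SLOTWISE
# SUCCESSOR IDENTIFICATIONS of the monic tuple game and their transfers (rescaled plane permutations are free moves)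

Crux item stmt-ResolutionOfSingularities-8899 `LocalWeightedDrop` (route `ResolutionOfSingularities/WeightedInvariant`), registered skeleton v30
(09f812eb3be8b7d8), stub S3ρ `stub_wildMonicSurfaceReductionWon`; LINE «monic polyhedron descent» of res-L1-w43-lead-1
(`L/res-L1-w43-lead-1/g3/poly_descent_line_v1.lean` 905148e143a15d9b), sub-stub (ρ-B) `PolyDescent.stub_polyBridge` (owner res-D-pv-058 acting as
res-L1-w43-stub-6; CUT 08:22:18Z item (B-i)).  [OURS · L1 W4.3, chain w43; free hand res-type-061 on the owner's offer.  A slot-by-slot port of lead-1's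
pure lemmas `PureDescent.slice_zero_eq / slice_one_eq / curveSlice_zero_eq / curveSlice_one_eq` (…PureDescentBridge, p508296) and of res-type-083's
`WildMonic.won_monic_scale_iff` (…WildMonicDescentNormal); nothing here is a statement of any manuscript.]

For a monic tuple `A : Fin d → k⟦u₁,u₂⟧` (germ `y^d + Σ_{j<d} A_j y^j`) the bricks of the surface game present the successors as MONIC TUPLES AGAIN:
* the POINT blow-up (`won_monic_of_pointBlowup_slot`), exceptional point `c`, slot `i₀`: the tuple `j ↦ (s · B_j)|_{slice i₀}` where
  `A_j ∘ chart(c) = s^{d−j+1} · B_j`;  * the blow-up of the CURVE `V(y, u_i)` (`won_monic_of_curveBlowup`): the tuple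
  `j ↦ c_i^{d−j} · (A′_j ∘ chart_{e_i}(c_i))|_{slice i}` where `A_j = u_i^{d−j} A′_j`.
THE IDENTIFICATIONS (each = the pure lemma with `q := d − j`, slot by slot):
* `slice_zero_eq_blowOneT` — slot `0`, `c₀ ≠ 0`: `(s·B_j)| = c₀^{d−j} · (blowOneT d (shearT (c₁/c₀) A))_j (c₀u₁, c₀⁻¹u₂)`;
* `slice_one_eq_blowTwoT` — slot `1` at `c₀ = 0`: `(s·B_j)| = c₁^{d−j} · (blowTwoT d A)_j (c₁⁻¹u₂, c₁u₁)`;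
* `curveSlice_zero_eq'` / `curveSlice_one_eq'` — the curve successors are `c^{d−j} · A′_j(c u₁, u₂)` / `c^{d−j} · A′_j(u₂, c u₁)`.
THE TRANSFERS (rescaled plane permutations and `y ↦ γy` are free moves of the game): `won_monic_C_pow_mul_iff` (`(γ^{d−j} · T_j)_j` won iff `T`
won), `won_monic_diag_iff`, `won_monic_swapDiag_iff`; hence `won_pointSucc_zero_iff` (slot-`0` successor won iff the monic germ of
`blowOneT d (shearT (c₁/c₀) A)` is won), `won_pointSucc_one_iff` (slot `1` at `c₀ = 0` ↔ `blowTwoT d A`), `won_curveSucc_zero_iff` / `won_curveSucc_one_iff`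
(↔ the monic germ of `A′`).  Elementary bookkeeping over landed lemmas.
-/

set_option linter.dupNamespace false -- mandated namespace of this single-conjunct summit

noncomputable section

namespace Summit.ResolutionOfSingularities.ResolutionOfSingularities.Theorems

namespace PolyDescent

open MvPowerSeries MonicDescent WildMonic Literature.AlgebraicGeometry.Resolution
  Literature.AlgebraicGeometry.Resolution.CobordantGame

variable {k : Type} [Field k] {d : ℕ}

/-! ## The two scaled permutations of the plane -/

/-- The diagonal family of `…PureDescentBridgeTools` is `PlaneGerm.diagScale`. -/
theorem diagFamily_eq_diagScale (b₀ b₁ : k) :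
    (fun l : Fin 2 => if l = 0 then C b₀ * X 0 else C b₁ * (X 1 : MvPowerSeries (Fin 2) k)) = PlaneGerm.diagScale b₀ b₁ := by
  funext l
  fin_cases l <;> simp

/-- A substitution with zero constant terms commutes with constant factors. -/
theorem subst_C_mul_of_constantCoeff_zero (θ : Fin 2 → MvPowerSeries (Fin 2) k) (hθ : ∀ i, constantCoeff (θ i) = 0) (a : k)
    (F : MvPowerSeries (Fin 2) k) : subst θ (C a * F) = C a * subst θ F := by
  rw [subst_mul (hasSubst_of_constantCoeff_zero hθ), subst_C]

/-! ## Free moves on monic tuples: `y ↦ γ y`, scaled permutations of the plane -/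

/-- `y ↦ γy` IS A FREE MOVE on monic tuples: the monic germ of `(γ^{d−j} · T_j)_j` is won iff that of `T` is (`γ ≠ 0`). -/
theorem won_monic_C_pow_mul_iff {γ : k} (hγ : γ ≠ 0) (T : Fin d → MvPowerSeries (Fin 2) k) :
    CobordantGame.Won k (2 + 1) (X (Fin.last 2) ^ d + ∑ j : Fin d, rename (Fin.succAboveEmb (Fin.last 2))
        (C (γ ^ (d - (j : ℕ))) * T j) * X (Fin.last 2) ^ (j : ℕ)) ↔
      CobordantGame.Won k (2 + 1) (X (Fin.last 2) ^ d +
        ∑ j : Fin d, rename (Fin.succAboveEmb (Fin.last 2)) (T j) * X (Fin.last 2) ^ (j : ℕ)) := by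
  -- `T = (T ∘ diag(γ⁻¹, γ)) ∘ diag(γ, γ⁻¹)`: combine the scale lemma with the free plane change `diag(γ⁻¹, γ)`
  have hs := won_monic_scale_iff hγ d (fun j => subst (PlaneGerm.diagScale γ⁻¹ γ⁻¹⁻¹) (T j))
  have hcomp : ∀ j : Fin d, subst (PlaneGerm.diagScale γ γ⁻¹) (subst (PlaneGerm.diagScale γ⁻¹ γ⁻¹⁻¹) (T j)) = T j := fun j => by
    rw [BlowupScaling.subst_diagScale_subst_diagScale, inv_mul_cancel₀ hγ, inv_inv, mul_inv_cancel₀ hγ,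
      BlowupScaling.subst_diagScale_one]
  simp only [hcomp] at hs
  rw [hs]
  exact won_monic_substX_iff (PlaneGerm.diagScale γ⁻¹ γ⁻¹⁻¹) (PlaneGerm.constantCoeff_diagScale γ⁻¹ γ⁻¹⁻¹)
    (by rw [WildPurePower.linMat_diagScale_det, inv_inv, inv_mul_cancel₀ hγ]; exact isUnit_one) T

/-- A RESCALED DIAGONAL CHANGE OF THE PLANE together with `y ↦ γy` is a free move: the monic germ of `(γ^{d−j} · T_j(b₀u₁, b₁u₂))_j` is won iff
that of `T` is (`γ, b₀, b₁ ≠ 0`). -/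
theorem won_monic_diag_iff {γ b₀ b₁ : k} (hγ : γ ≠ 0) (hb₀ : b₀ ≠ 0) (hb₁ : b₁ ≠ 0) (T : Fin d → MvPowerSeries (Fin 2) k) :
    CobordantGame.Won k (2 + 1) (X (Fin.last 2) ^ d + ∑ j : Fin d, rename (Fin.succAboveEmb (Fin.last 2))
        (C (γ ^ (d - (j : ℕ))) * subst (fun l : Fin 2 => if l = 0 then C b₀ * X 0 else C b₁ * (X 1 : MvPowerSeries (Fin 2) k)) (T j)) *
          X (Fin.last 2) ^ (j : ℕ)) ↔
      CobordantGame.Won k (2 + 1) (X (Fin.last 2) ^ d +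
        ∑ j : Fin d, rename (Fin.succAboveEmb (Fin.last 2)) (T j) * X (Fin.last 2) ^ (j : ℕ)) := by
  have hθ0 := PureDescent.constantCoeff_diag (k := k) b₀ b₁
  have hpush : ∀ j : Fin d, C (γ ^ (d - (j : ℕ))) *
      subst (fun l : Fin 2 => if l = 0 then C b₀ * X 0 else C b₁ * (X 1 : MvPowerSeries (Fin 2) k)) (T j) =
      subst (fun l : Fin 2 => if l = 0 then C b₀ * X 0 else C b₁ * (X 1 : MvPowerSeries (Fin 2) k)) (C (γ ^ (d - (j : ℕ))) * T j) :=
    fun j => (subst_C_mul_of_constantCoeff_zero _ hθ0 _ _).symm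
  simp only [hpush]
  rw [won_monic_substX_iff _ hθ0 (PureDescent.isUnit_det_diag hb₀ hb₁)]
  exact won_monic_C_pow_mul_iff hγ T

/-- A RESCALED SWAP OF THE PLANE together with `y ↦ γy` is a free move: the monic germ of `(γ^{d−j} · T_j(b₀u₂, b₁u₁))_j` is won iff that of `T`
is (`γ, b₀, b₁ ≠ 0`). -/
theorem won_monic_swapDiag_iff {γ b₀ b₁ : k} (hγ : γ ≠ 0) (hb₀ : b₀ ≠ 0) (hb₁ : b₁ ≠ 0) (T : Fin d → MvPowerSeries (Fin 2) k) :
    CobordantGame.Won k (2 + 1) (X (Fin.last 2) ^ d + ∑ j : Fin d, rename (Fin.succAboveEmb (Fin.last 2))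
        (C (γ ^ (d - (j : ℕ))) * subst (fun l : Fin 2 => if l = 0 then C b₀ * X 1 else C b₁ * (X 0 : MvPowerSeries (Fin 2) k)) (T j)) *
          X (Fin.last 2) ^ (j : ℕ)) ↔
      CobordantGame.Won k (2 + 1) (X (Fin.last 2) ^ d +
        ∑ j : Fin d, rename (Fin.succAboveEmb (Fin.last 2)) (T j) * X (Fin.last 2) ^ (j : ℕ)) := by
  have hθ0 := PureDescent.constantCoeff_swapDiag (k := k) b₀ b₁
  have hpush : ∀ j : Fin d, C (γ ^ (d - (j : ℕ))) *
      subst (fun l : Fin 2 => if l = 0 then C b₀ * X 1 else C b₁ * (X 0 : MvPowerSeries (Fin 2) k)) (T j) =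
      subst (fun l : Fin 2 => if l = 0 then C b₀ * X 1 else C b₁ * (X 0 : MvPowerSeries (Fin 2) k)) (C (γ ^ (d - (j : ℕ))) * T j) :=
    fun j => (subst_C_mul_of_constantCoeff_zero _ hθ0 _ _).symm
  simp only [hpush]
  rw [won_monic_substX_iff _ hθ0 (PureDescent.isUnit_det_swapDiag hb₀ hb₁)]
  exact won_monic_C_pow_mul_iff hγ T

/-! ## The point blow-up: slot `0` and slot `1` -/

section Point

variable (c : Fin 2 → k) (A : Fin d → MvPowerSeries (Fin 2) k) (B : Fin d → MvPowerSeries (Fin (2 + 1)) k)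
  (hB : ∀ j : Fin d, subst (CobordantChart.chart (fun _ : Fin 2 => 1) c) (A j) = X 0 ^ (d - (j : ℕ) + 1) * B j)

include hB in
/-- POINT STEP, SLOT `0` (`c₀ ≠ 0`), slot by slot: the successor coefficient is `c₀^{d−j} · (blowOneT d (shearT (c₁/c₀) A))_j (c₀u₁, c₀⁻¹u₂)`. -/
theorem slice_zero_eq_blowOneT (hc : c 0 ≠ 0) (j : Fin d) :
    TupleGame.slice (0 : Fin 2) (X 0 * B j) =
      C (c 0 ^ (d - (j : ℕ))) * subst (fun l : Fin 2 => if l = 0 then C (c 0) * X 0 else C (c 0)⁻¹ * (X 1 : MvPowerSeries (Fin 2) k))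
        (blowOneT d (shearT (C (c 1 / c 0)) A) j) :=
  PureDescent.slice_zero_eq (q := d - (j : ℕ)) c hc (A j) (B j) (hB j)

include hB in
/-- THE SLOT-`0` SUCCESSOR IS WON IFF the monic germ of `blowOneT d (shearT (c₁/c₀) A)` is won (`c₀ ≠ 0`). -/
theorem won_pointSucc_zero_iff (hc : c 0 ≠ 0) :
    CobordantGame.Won k (2 + 1) (X (Fin.last 2) ^ d +
        ∑ j : Fin d, rename (Fin.succAboveEmb (Fin.last 2)) (TupleGame.slice (0 : Fin 2) (X 0 * B j)) * X (Fin.last 2) ^ (j : ℕ)) ↔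
      CobordantGame.Won k (2 + 1) (X (Fin.last 2) ^ d +
        ∑ j : Fin d, rename (Fin.succAboveEmb (Fin.last 2)) (blowOneT d (shearT (C (c 1 / c 0)) A) j) * X (Fin.last 2) ^ (j : ℕ)) := by
  simp only [slice_zero_eq_blowOneT c A B hB hc]
  exact won_monic_diag_iff hc hc (inv_ne_zero hc) _

include hB in
/-- POINT STEP, SLOT `1` AT `c₀ = 0` (`c₁ ≠ 0`), slot by slot: the successor coefficient is `c₁^{d−j} · (blowTwoT d A)_j (c₁⁻¹u₂, c₁u₁)`. -/
theorem slice_one_eq_blowTwoT (hc0 : c 0 = 0) (hc : c 1 ≠ 0) (j : Fin d) :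
    TupleGame.slice (1 : Fin 2) (X 0 * B j) =
      C (c 1 ^ (d - (j : ℕ))) * subst (fun l : Fin 2 => if l = 0 then C (c 1)⁻¹ * X 1 else C (c 1) * (X 0 : MvPowerSeries (Fin 2) k))
        (blowTwoT d A j) :=
  PureDescent.slice_one_eq (q := d - (j : ℕ)) c hc0 hc (A j) (B j) (hB j)

include hB in
/-- THE SLOT-`1` SUCCESSOR AT `c₀ = 0` IS WON IFF the monic germ of `blowTwoT d A` is won. -/
theorem won_pointSucc_one_iff (hc0 : c 0 = 0) (hc : c 1 ≠ 0) :
    CobordantGame.Won k (2 + 1) (X (Fin.last 2) ^ d +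
        ∑ j : Fin d, rename (Fin.succAboveEmb (Fin.last 2)) (TupleGame.slice (1 : Fin 2) (X 0 * B j)) * X (Fin.last 2) ^ (j : ℕ)) ↔
      CobordantGame.Won k (2 + 1) (X (Fin.last 2) ^ d +
        ∑ j : Fin d, rename (Fin.succAboveEmb (Fin.last 2)) (blowTwoT d A j) * X (Fin.last 2) ^ (j : ℕ)) := by
  simp only [slice_one_eq_blowTwoT c A B hB hc0 hc]
  exact won_monic_swapDiag_iff hc (inv_ne_zero hc) hc _

end Point

/-! ## The curve blow-ups `V(y,u₁)`, `V(y,u₂)` -/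

/-- CURVE STEP `V(y,u₁)`, slot by slot: the successor coefficient is `c^{d−j} · A′_j(c u₁, u₂)`. -/
theorem curveSlice_zero_eq' (ci : k) (A' : Fin d → MvPowerSeries (Fin 2) k) (j : Fin d) :
    C (ci ^ (d - (j : ℕ))) * TupleGame.slice (0 : Fin 2) (subst (CobordantChart.chart (fun l : Fin 2 => if l = 0 then 1 else 0)
        (fun l : Fin 2 => if l = 0 then ci else 0)) (A' j)) =
      C (ci ^ (d - (j : ℕ))) * subst (fun l : Fin 2 => if l = 0 then C ci * X 0 else C 1 * (X 1 : MvPowerSeries (Fin 2) k)) (A' j) :=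
  PureDescent.curveSlice_zero_eq (q := d - (j : ℕ)) ci (A' j)

/-- THE `V(y,u₁)`-SUCCESSOR IS WON IFF the monic germ of `A′` is won (`c ≠ 0`). -/
theorem won_curveSucc_zero_iff {ci : k} (hci : ci ≠ 0) (A' : Fin d → MvPowerSeries (Fin 2) k) :
    CobordantGame.Won k (2 + 1) (X (Fin.last 2) ^ d +
        ∑ j : Fin d, rename (Fin.succAboveEmb (Fin.last 2))
          (C (ci ^ (d - (j : ℕ))) * TupleGame.slice (0 : Fin 2) (subst (CobordantChart.chart (fun l : Fin 2 => if l = 0 then 1 else 0)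
            (fun l : Fin 2 => if l = 0 then ci else 0)) (A' j))) * X (Fin.last 2) ^ (j : ℕ)) ↔
      CobordantGame.Won k (2 + 1) (X (Fin.last 2) ^ d +
        ∑ j : Fin d, rename (Fin.succAboveEmb (Fin.last 2)) (A' j) * X (Fin.last 2) ^ (j : ℕ)) := by
  simp only [curveSlice_zero_eq']
  exact won_monic_diag_iff hci hci one_ne_zero _

/-- CURVE STEP `V(y,u₂)`, slot by slot: the successor coefficient is `c^{d−j} · A′_j(u₂, c u₁)` (letters swapped). -/
theorem curveSlice_one_eq' (ci : k) (A' : Fin d → MvPowerSeries (Fin 2) k) (j : Fin d) :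
    C (ci ^ (d - (j : ℕ))) * TupleGame.slice (1 : Fin 2) (subst (CobordantChart.chart (fun l : Fin 2 => if l = 1 then 1 else 0)
        (fun l : Fin 2 => if l = 1 then ci else 0)) (A' j)) =
      C (ci ^ (d - (j : ℕ))) * subst (fun l : Fin 2 => if l = 0 then C 1 * X 1 else C ci * (X 0 : MvPowerSeries (Fin 2) k)) (A' j) :=
  PureDescent.curveSlice_one_eq (q := d - (j : ℕ)) ci (A' j)

/-- THE `V(y,u₂)`-SUCCESSOR IS WON IFF the monic germ of `A′` is won (`c ≠ 0`). -/
theorem won_curveSucc_one_iff {ci : k} (hci : ci ≠ 0) (A' : Fin d → MvPowerSeries (Fin 2) k) :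
    CobordantGame.Won k (2 + 1) (X (Fin.last 2) ^ d +
        ∑ j : Fin d, rename (Fin.succAboveEmb (Fin.last 2))
          (C (ci ^ (d - (j : ℕ))) * TupleGame.slice (1 : Fin 2) (subst (CobordantChart.chart (fun l : Fin 2 => if l = 1 then 1 else 0)
            (fun l : Fin 2 => if l = 1 then ci else 0)) (A' j))) * X (Fin.last 2) ^ (j : ℕ)) ↔
      CobordantGame.Won k (2 + 1) (X (Fin.last 2) ^ d +
        ∑ j : Fin d, rename (Fin.succAboveEmb (Fin.last 2)) (A' j) * X (Fin.last 2) ^ (j : ℕ)) := by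
  simp only [curveSlice_one_eq']
  exact won_monic_swapDiag_iff hci one_ne_zero hci _

end PolyDescent

end Summit.ResolutionOfSingularities.ResolutionOfSingularities.Theorems

end
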